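import Summits.QuantumFields.YangMills.Theorems.PencilRigidityWeakCouplingHypercubicLimitOfRpCore
import Summits.QuantumFields.YangMills.Theorems.PencilRigidityWeakCouplingHypercubicLimitStubDisjointOfLatticeFloor
import Summits.QuantumFields.YangMills.Theorems.PencilRigidityWeakCouplingHypercubicLimitStubCompactOfDisjoint
import Summits.QuantumFields.YangMills.Theorems.PencilRigidityWeakCouplingHypercubicLimitStubLocaliseOfCompact
import Summits.QuantumFields.YangMills.Theorems.PencilRigidityWeakCouplingHypercubicLimitStubSeparatingCoordinate
import Summits.QuantumFields.YangMills.Theorems.PencilRigidityWeakCouplingHypercubicLimitStubTimeSeparatedOfSeparated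
import HarnessLib

/-!
# Crux `WeakCouplingHypercubicLimit` (stmt-QuantumFields-16120) from the DISJOINT RP CORE — the `κ₃` geometry is not an input

Line `Sketch` of crux stmt-16120, continuation lead c7, reshape r15b.  The landed closure `weakCouplingHypercubicLimit_of_rpCore`
(`…OfRpCore.lean`, lead c6) asks for the non-Gaussianity floor in TIME-SEPARATED position (`f` below, `g ⟂ h` above the time-zero
hyperplane), because non-triviality is read off by RP Cauchy–Schwarz across that hyperplane (`stub_ntOfSkewSeparated`).  The geometry
is produced here from properties the limit family `planeSum T` already has — continuity of each `S₁ n`, E3 (`planeSum_isNormalized_isSymmetric`),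
translation invariance (`stub_translationPlanesMono`) and `W(B₄)` invariance (`stub_signedPermOfPlaneLimits`) on `⁰𝒮`:

* `skewSepDatum_of_disjointDatum` — a non-zero continuum `κ₃` on SOME pairwise-disjoint triple gives one in time-separated position:
  compact cut-offs (`stub_compactOfDisjoint`), localisation by a finite partition of unity to three small balls with far-apart centres
  (`stub_localiseOfCompact`), a separating coordinate hyperplane (`stub_separatingCoordinate`), transport by a signed permutation and a
  translation (`stub_timeSeparatedOfSeparated`);
* `oneFieldClauses_of_ufbDisjointCore` — the r12′ closure `oneFieldClauses_of_ufbSkewCore` with the lattice floor passed to the limit in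
  pairwise-disjoint geometry (`stub_disjointOfLatticeFloor`) and the datum time-separated by the above before `stub_ntOfSkewSeparated`;
* `weakCouplingHypercubicLimit_of_rpCoreDisjoint` / `hypercubicLimit_of_rpCoreDisjoint` — stmt-16120 / stmt-16154 BY NAME from the
  DISJOINT RP CORE: weak coupling ∧ `PolyVolume` ∧ `PolyRenorm` ∧ `UniformFunctionalBoundPlanes` ∧ (∃ Δ C, 0 < Δ ∧ RPSpectral) ∧ ONE `κ₃`
  floor on some pairwise-disjoint real triple (`IRInputs` (d) verbatim) — the common core of the two cruxes, one clause lighter in geometry.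

Refs: OsterwalderSchrader1973 §2–3 (test-function spaces, E1, E3); OsterwalderSeiler1978 §2; GlimmJaffe1987 §6.1, §19.7.
-/

noncomputable section

open scoped SchwartzMap
open MeasureTheory Filter Topology
open Literature.MathematicalPhysics.AQFT Literature.MathematicalPhysics.QuantumLattice
open Literature.MathematicalPhysics.QuantumFieldTheory

namespace Summit.QuantumFields.YangMills.Theorems.WeakCouplingHypercubicLimit.TraceNormColdPressure

open Summit.QuantumFields.YangMills.Cruxes.HypercubicLimit.CouplingResponse
open Summit.QuantumFields.YangMills.Cruxes.OSLegsFromFemtoAndGap.DlrCollarTransfer (conn Decay RPPos ConnCS)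

/-- **Time-separated non-Gaussianity data from a pairwise-disjoint one** (r15 glue N2a → N2b → N3a → N3b): for a one-field
family that is symmetric, translation invariant and signed-permutation invariant on `⁰𝒮`, a non-vanishing third cumulant on SOME
pairwise-disjoint triple yields one in time-separated position. -/
theorem skewSepDatum_of_disjointDatum (S₁ : SchwingerFamily (EuclideanSpace ℝ (Fin 4)))
    (hE3 : ∀ (n : ℕ) (π : Equiv.Perm (Fin n)) (F : 𝓢((Fin n → EuclideanSpace ℝ (Fin 4)), ℂ)), IsOffDiagonal F →
      S₁ n (permTest π F) = S₁ n F)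
    (htr : ∀ (n : ℕ) (a : EuclideanSpace ℝ (Fin 4)) (F : 𝓢((Fin n → EuclideanSpace ℝ (Fin 4)), ℂ)), IsOffDiagonal F →
      S₁ n (translateMulti a F) = S₁ n F)
    (hSP : ∀ (n : ℕ) (R : EuclideanSpace ℝ (Fin 4) ≃ₗᵢ[ℝ] EuclideanSpace ℝ (Fin 4)),
      (∀ i : Fin 4, ∃ j : Fin 4, R (EuclideanSpace.single i 1) = EuclideanSpace.single j 1 ∨
        R (EuclideanSpace.single i 1) = -EuclideanSpace.single j 1) →
      ∀ F : 𝓢((Fin n → EuclideanSpace ℝ (Fin 4)), ℂ), IsOffDiagonal F → S₁ n (linActMulti R F) = S₁ n F)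
    (hD : ∃ (f g h : 𝓢(EuclideanSpace ℝ (Fin 4), ℂ)),
      Disjoint (tsupport (f : EuclideanSpace ℝ (Fin 4) → ℂ)) (tsupport (g : EuclideanSpace ℝ (Fin 4) → ℂ)) ∧
      Disjoint (tsupport (f : EuclideanSpace ℝ (Fin 4) → ℂ)) (tsupport (h : EuclideanSpace ℝ (Fin 4) → ℂ)) ∧
      Disjoint (tsupport (g : EuclideanSpace ℝ (Fin 4) → ℂ)) (tsupport (h : EuclideanSpace ℝ (Fin 4) → ℂ)) ∧
      S₁ 3 (SchwartzMap.tensorFin 3 ![f, g, h]) -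
          S₁ 1 (SchwartzMap.tensorFin 1 ![f]) * S₁ 2 (SchwartzMap.tensorFin 2 ![g, h]) -
        S₁ 1 (SchwartzMap.tensorFin 1 ![g]) * S₁ 2 (SchwartzMap.tensorFin 2 ![f, h]) -
        S₁ 1 (SchwartzMap.tensorFin 1 ![h]) * S₁ 2 (SchwartzMap.tensorFin 2 ![f, g]) +
        2 * (S₁ 1 (SchwartzMap.tensorFin 1 ![f]) * S₁ 1 (SchwartzMap.tensorFin 1 ![g]) *
          S₁ 1 (SchwartzMap.tensorFin 1 ![h])) ≠ 0) :
    ∃ (f' g' h' : 𝓢(EuclideanSpace ℝ (Fin 4), ℂ)) (Ffgh : 𝓢((Fin 3 → EuclideanSpace ℝ (Fin 4)), ℂ))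
      (Fgh Ffh Ffg : 𝓢((Fin 2 → EuclideanSpace ℝ (Fin 4)), ℂ)) (Ff Fg Fh : 𝓢((Fin 1 → EuclideanSpace ℝ (Fin 4)), ℂ)),
      tsupport (f' : EuclideanSpace ℝ (Fin 4) → ℂ) ⊆ {y : EuclideanSpace ℝ (Fin 4) | y 0 < 0} ∧
      tsupport (g' : EuclideanSpace ℝ (Fin 4) → ℂ) ⊆ {y : EuclideanSpace ℝ (Fin 4) | 0 < y 0} ∧
      tsupport (h' : EuclideanSpace ℝ (Fin 4) → ℂ) ⊆ {y : EuclideanSpace ℝ (Fin 4) | 0 < y 0} ∧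
      IsOffDiagonal Fgh ∧ IsTensorOf Ffgh ![f', g', h'] ∧ IsOffDiagonal Ffgh ∧ IsTensorOf Fgh ![g', h'] ∧
      IsTensorOf Ffh ![f', h'] ∧ IsTensorOf Ffg ![f', g'] ∧ IsTensorOf Ff ![f'] ∧ IsTensorOf Fg ![g'] ∧ IsTensorOf Fh ![h'] ∧
      S₁.toLabelled 3 (fun _ => ()) Ffgh - S₁.toLabelled 1 (fun _ => ()) Ff * S₁.toLabelled 2 (fun _ => ()) Fgh -
        S₁.toLabelled 1 (fun _ => ()) Fg * S₁.toLabelled 2 (fun _ => ()) Ffh -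
        S₁.toLabelled 1 (fun _ => ()) Fh * S₁.toLabelled 2 (fun _ => ()) Ffg +
        2 * (S₁.toLabelled 1 (fun _ => ()) Ff * S₁.toLabelled 1 (fun _ => ()) Fg * S₁.toLabelled 1 (fun _ => ()) Fh) ≠ 0 := by
  obtain ⟨f, g, h, hfg, hfh, hgh, hκ⟩ := hD
  obtain ⟨f₁, g₁, h₁, hcf, hcg, hch, hf₁, hg₁, hh₁, hκ₁⟩ := stub_compactOfDisjoint S₁ f g h hfg hfh hgh hκ
  obtain ⟨f₂, g₂, h₂, p, q, w, ρ, hρ, hf₂, hg₂, hh₂, hpq, hpw, hqw, hκ₂⟩ :=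
    stub_localiseOfCompact S₁ f₁ g₁ h₁ hcf hcg hch (hfg.mono hf₁ hg₁) (hfh.mono hf₁ hh₁) (hgh.mono hg₁ hh₁) hκ₁
  obtain ⟨m, c, hcases⟩ := stub_separatingCoordinate p q w ρ hρ hpq hpw hqw
  -- the three balls are pairwise disjoint (centres `≥ 10ρ` apart), hence so are the localised supports
  have hdj : ∀ {x y : EuclideanSpace ℝ (Fin 4)}, 10 * ρ ≤ dist x y →
      Disjoint (Metric.closedBall x ρ) (Metric.closedBall y ρ) := fun hxy =>
    Metric.closedBall_disjoint_closedBall (by linarith)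
  exact stub_timeSeparatedOfSeparated S₁ hE3 htr hSP f₂ g₂ h₂ p q w ρ hρ hf₂ hg₂ hh₂
    (Set.disjoint_of_subset hf₂ hg₂ (hdj hpq)) (Set.disjoint_of_subset hf₂ hh₂ (hdj hpw))
    (Set.disjoint_of_subset hg₂ hh₂ (hdj hqw)) m c hcases hκ₂

/-- **The UFB disjoint core gives a weak-coupling one-field witness** (r15; the `κ₃` floor in PAIRWISE-DISJOINT geometry,
`IRInputs` (d) verbatim). -/
theorem oneFieldClauses_of_ufbDisjointCore
    {G : Type} [Group G] [TopologicalSpace G] [IsTopologicalGroup G] [CompactSpace G] [MeasurableSpace G] [BorelSpace G]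
    (r : LatticeRep G) (sch : SpeciesScheme (YMSpecies G))
    (hw : sch.HasWeakCouplingLimit) (hpv : PolyVolume sch) (hpr : PolyRenorm r sch) (hUFB : UniformFunctionalBoundPlanes r sch)
    (hM1 : ∃ (s : ℕ) (C : ℝ), ∀ F : Plane → 𝓢(EuclideanSpace ℝ (Fin 4), ℝ), normP s F ≤ 1 →
      ∀ k : ℕ, |∫ U, fieldP r sch k F U ∂(wilsonAt r sch k)| ≤ C)
    {Δ C : ℝ} (hΔ : 0 < Δ) (hgap : HasLatticeMassGap r sch Δ) (hrp : RPSpectral r sch Δ C)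
    (hNG : ∃ (f g h : 𝓢(EuclideanSpace ℝ (Fin 4), ℝ)) (δ : ℝ),
        Disjoint (tsupport f) (tsupport g) ∧ Disjoint (tsupport f) (tsupport h) ∧
        Disjoint (tsupport g) (tsupport h) ∧ 0 < δ ∧
        ∀ᶠ k in atTop, δ ≤
          |latticeSchwinger r.ρ sch (fun s => s.F) k 3 (fun _ => r.curvature) ![f, g, h] -
            latticeSchwinger r.ρ sch (fun s => s.F) k 1 (fun _ => r.curvature) ![f] *
              latticeSchwinger r.ρ sch (fun s => s.F) k 2 (fun _ => r.curvature) ![g, h] -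
            latticeSchwinger r.ρ sch (fun s => s.F) k 1 (fun _ => r.curvature) ![g] *
              latticeSchwinger r.ρ sch (fun s => s.F) k 2 (fun _ => r.curvature) ![f, h] -
            latticeSchwinger r.ρ sch (fun s => s.F) k 1 (fun _ => r.curvature) ![h] *
              latticeSchwinger r.ρ sch (fun s => s.F) k 2 (fun _ => r.curvature) ![f, g] +
            2 * (latticeSchwinger r.ρ sch (fun s => s.F) k 1 (fun _ => r.curvature) ![f] *
              latticeSchwinger r.ρ sch (fun s => s.F) k 1 (fun _ => r.curvature) ![g] *
              latticeSchwinger r.ρ sch (fun s => s.F) k 1 (fun _ => r.curvature) ![h])|) :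
    ∃ (sch' : SpeciesScheme (YMSpecies G)) (S₁ : SchwingerFamily (EuclideanSpace ℝ (Fin 4))), sch'.HasWeakCouplingLimit ∧ OneFieldClauses r sch' S₁ := by
  -- bounded counterterms from the order-one bound and the κ₃ floor
  have hbm : ∃ Cm : ℝ, ∀ k, |sch.m r.curvature k| ≤ Cm := by
    obtain ⟨f, g, h, δ, -, -, -, hδ, hev⟩ := hNG
    exact countertermBound_of_momentOne_skewFloor G r sch hM1 ⟨f, g, h, δ, hδ, hev⟩
  -- compactness along a subsequence
  obtain ⟨φ, hφ, T, hPL⟩ := stub_planeLimits G r sch hUFB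
  have hβ0 : ∀ᶠ k in atTop, 0 ≤ sch.β k := hw.eventually_ge_atTop 0
  -- soft facts
  obtain ⟨hE0, hE3⟩ := planeSum_isNormalized_isSymmetric G r sch φ T hPL
  have hE0' := planeSum_hasLinearGrowth G r sch φ T hPL
  have htr := stub_translationPlanesMono G r sch φ hφ T hpv hpr hUFB hPL
  have hconv := convergence_subseq_of_planeLimits G r sch φ hφ T hPL
  -- reflection facts
  have hRP : RPPos (planeSum T) := stub_rpPosOfPlaneLimits G r sch φ hφ T hβ0 hUFB hPL
  have hSP := stub_signedPermOfPlaneLimits G r sch φ hφ T hUFB hPL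
  have hD : Decay (planeSum T) Δ := stub_decayOfRPSpectral G r sch φ hφ T Δ C hΔ hpv hpr hbm hUFB hPL hrp
  have hrefl : ReflHalf (planeSum T) Δ :=
    reflHalf_of_pieces (planeSum T) hΔ hE0 (fun n _ a F hF => htr n a F hF) hRP hSP hD
  -- `ConnCS` of the limit
  have hN' : ∀ F : 𝓢((Fin 0 → EuclideanSpace ℝ (Fin 4)), ℂ), planeSum T 0 F = F default := fun F =>
    (hE0 (fun _ => ()) F).trans (congrArg F (Subsingleton.elim _ _))
  have htrans' : ∀ (n : ℕ) (t : EuclideanSpace ℝ (Fin 4)) (F : 𝓢((Fin n → EuclideanSpace ℝ (Fin 4)), ℂ)), IsOffDiagonal F →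
      planeSum T n (translateMulti t F) = planeSum T n F := fun n t F hF => htr n t F hF
  obtain ⟨hCS, -⟩ :=
    Summit.QuantumFields.YangMills.Cruxes.OSLegsFromFemtoAndGap.DlrCollarTransfer.stub_gap (planeSum T) hN' htrans' hRP
  -- the κ₃ floor along the subsequence, its continuum PAIRWISE-DISJOINT datum, time separation by symmetry, non-triviality
  have hNG' : ∃ (f g h : 𝓢(EuclideanSpace ℝ (Fin 4), ℝ)) (δ : ℝ),
      Disjoint (tsupport f) (tsupport g) ∧ Disjoint (tsupport f) (tsupport h) ∧
      Disjoint (tsupport g) (tsupport h) ∧ 0 < δ ∧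
      ∀ᶠ k in atTop, δ ≤
        |latticeSchwinger r.ρ (subseq sch φ hφ) (fun s => s.F) k 3 (fun _ => r.curvature) ![f, g, h] -
          latticeSchwinger r.ρ (subseq sch φ hφ) (fun s => s.F) k 1 (fun _ => r.curvature) ![f] *
            latticeSchwinger r.ρ (subseq sch φ hφ) (fun s => s.F) k 2 (fun _ => r.curvature) ![g, h] -
          latticeSchwinger r.ρ (subseq sch φ hφ) (fun s => s.F) k 1 (fun _ => r.curvature) ![g] *
            latticeSchwinger r.ρ (subseq sch φ hφ) (fun s => s.F) k 2 (fun _ => r.curvature) ![f, h] -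
          latticeSchwinger r.ρ (subseq sch φ hφ) (fun s => s.F) k 1 (fun _ => r.curvature) ![h] *
            latticeSchwinger r.ρ (subseq sch φ hφ) (fun s => s.F) k 2 (fun _ => r.curvature) ![f, g] +
          2 * (latticeSchwinger r.ρ (subseq sch φ hφ) (fun s => s.F) k 1 (fun _ => r.curvature) ![f] *
            latticeSchwinger r.ρ (subseq sch φ hφ) (fun s => s.F) k 1 (fun _ => r.curvature) ![g] *
            latticeSchwinger r.ρ (subseq sch φ hφ) (fun s => s.F) k 1 (fun _ => r.curvature) ![h])| := by
    obtain ⟨f, g, h, δ, hfg, hfh, hgh, hδ, hev⟩ := hNG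
    exact ⟨f, g, h, δ, hfg, hfh, hgh, hδ, eventually_subseq hφ hev⟩
  have hdisj := stub_disjointOfLatticeFloor G r (subseq sch φ hφ) (planeSum T) hconv hNG'
  have hE3' : ∀ (n : ℕ) (π : Equiv.Perm (Fin n)) (F : 𝓢((Fin n → EuclideanSpace ℝ (Fin 4)), ℂ)), IsOffDiagonal F →
      planeSum T n (permTest π F) = planeSum T n F := fun n π F hF => hE3 n (fun _ => ()) π F hF
  have hsep := skewSepDatum_of_disjointDatum (planeSum T) hE3' htrans' hSP hdisj
  have hNT := stub_ntOfSkewSeparated (planeSum T) hCS hsep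
  have hNGc : ∃ (f g h : 𝓢(EuclideanSpace ℝ (Fin 4), ℂ)) (Ffgh : 𝓢((Fin 3 → EuclideanSpace ℝ (Fin 4)), ℂ)) (Fgh Ffh Ffg : 𝓢((Fin 2 → EuclideanSpace ℝ (Fin 4)), ℂ))
      (Ff Fg Fh : 𝓢((Fin 1 → EuclideanSpace ℝ (Fin 4)), ℂ)),
      IsTensorOf Ffgh ![f, g, h] ∧ IsOffDiagonal Ffgh ∧ IsTensorOf Fgh ![g, h] ∧
      IsTensorOf Ffh ![f, h] ∧ IsTensorOf Ffg ![f, g] ∧ IsTensorOf Ff ![f] ∧ IsTensorOf Fg ![g] ∧ IsTensorOf Fh ![h] ∧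
      (planeSum T).toLabelled 3 (fun _ => ()) Ffgh -
          (planeSum T).toLabelled 1 (fun _ => ()) Ff * (planeSum T).toLabelled 2 (fun _ => ()) Fgh -
        (planeSum T).toLabelled 1 (fun _ => ()) Fg * (planeSum T).toLabelled 2 (fun _ => ()) Ffh -
        (planeSum T).toLabelled 1 (fun _ => ()) Fh * (planeSum T).toLabelled 2 (fun _ => ()) Ffg +
        2 * ((planeSum T).toLabelled 1 (fun _ => ()) Ff * (planeSum T).toLabelled 1 (fun _ => ()) Fg *
          (planeSum T).toLabelled 1 (fun _ => ()) Fh) ≠ 0 := by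
    obtain ⟨f, g, h, Ffgh, Fgh, Ffh, Ffg, Ff, Fg, Fh, -, -, -, -, h1, h2, h3, h4, h5, h6, h7, h8, h9⟩ := hsep
    exact ⟨f, g, h, Ffgh, Fgh, Ffh, Ffg, Ff, Fg, Fh, h1, h2, h3, h4, h5, h6, h7, h8, h9⟩
  -- assemble the soft half and conclude
  have hsoft : SoftHalf r (subseq sch φ hφ) (planeSum T) Δ :=
    ⟨hE0, hE0', hE3, fun n _ a F hF => htr n a F hF, hconv, hNT, hNGc, hasLatticeMassGap_subseq r sch φ hφ hgap⟩
  exact ⟨subseq sch φ hφ, planeSum T, hasWeakCouplingLimit_subseq sch φ hφ hw, oneFieldClauses_of_halves r _ _ hΔ hsoft hrefl⟩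

/-- **The crux `WeakCouplingHypercubicLimit` (stmt-16120) BY NAME from the DISJOINT RP CORE** (registered heart S6i of line `Sketch`,
r15b): weak coupling ∧ `PolyVolume` ∧ `PolyRenorm` ∧ `UniformFunctionalBoundPlanes` ∧ (∃ Δ C, 0 < Δ ∧ `RPSpectral r sch Δ C`) ∧ ONE `κ₃`
floor on SOME pairwise-disjoint real triple ⇒ the existence-minus-rotations leg of `YangMills` in one-field gauge at weak coupling.  Lattice
gap at half the RP-spectral rate (`stub_gapOfRPSpectral`), RP-spectral rate realigned (`stub_rpSpectralAnti`), order-one bound from UFB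
(`momentOne_of_ufb`), then `oneFieldClauses_of_ufbDisjointCore`, ONE FIELD SUFFICES (`hypercubicLimit_iff_oneFieldWeak`) and the sibling
tie. [folklore] -/
theorem weakCouplingHypercubicLimit_of_rpCoreDisjoint :
    (∀ (G : Type) [Group G] [TopologicalSpace G] [IsTopologicalGroup G] [CompactSpace G]
          [MeasurableSpace G] [BorelSpace G], IsCompactSimpleLieGroup G →
          ∃ (r : LatticeRep G) (sch : SpeciesScheme (YMSpecies G)),
            sch.HasWeakCouplingLimit ∧ PolyVolume sch ∧ PolyRenorm r sch ∧ UniformFunctionalBoundPlanes r sch ∧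
            (∃ Δ C : ℝ, 0 < Δ ∧ RPSpectral r sch Δ C) ∧
            (∃ (f g h : 𝓢(EuclideanSpace ℝ (Fin 4), ℝ)) (δ : ℝ),
              Disjoint (tsupport f) (tsupport g) ∧ Disjoint (tsupport f) (tsupport h) ∧
              Disjoint (tsupport g) (tsupport h) ∧ 0 < δ ∧
              ∀ᶠ k in atTop, δ ≤
                |latticeSchwinger r.ρ sch (fun s => s.F) k 3 (fun _ => r.curvature) ![f, g, h] -
                  latticeSchwinger r.ρ sch (fun s => s.F) k 1 (fun _ => r.curvature) ![f] *
                    latticeSchwinger r.ρ sch (fun s => s.F) k 2 (fun _ => r.curvature) ![g, h] -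
                  latticeSchwinger r.ρ sch (fun s => s.F) k 1 (fun _ => r.curvature) ![g] *
                    latticeSchwinger r.ρ sch (fun s => s.F) k 2 (fun _ => r.curvature) ![f, h] -
                  latticeSchwinger r.ρ sch (fun s => s.F) k 1 (fun _ => r.curvature) ![h] *
                    latticeSchwinger r.ρ sch (fun s => s.F) k 2 (fun _ => r.curvature) ![f, g] +
                  2 * (latticeSchwinger r.ρ sch (fun s => s.F) k 1 (fun _ => r.curvature) ![f] *
                    latticeSchwinger r.ρ sch (fun s => s.F) k 1 (fun _ => r.curvature) ![g] *
                    latticeSchwinger r.ρ sch (fun s => s.F) k 1 (fun _ => r.curvature) ![h])|)) →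
    Summit.QuantumFields.YangMills.Theses.PencilRigidity.WeakCouplingHypercubicLimit := by
  intro hcore
  refine SiblingTie.stub_siblingTie.mpr
    (Summit.QuantumFields.YangMills.Theorems.HypercubicLimit.OneFieldWeak.hypercubicLimit_iff_oneFieldWeak.mpr
      fun G _ _ _ _ hG => ?_)
  letI : MeasurableSpace G := borel G
  haveI : BorelSpace G := ⟨rfl⟩
  obtain ⟨r, sch, hw, hpv, hpr, hUFB, ⟨Δ, C, hΔ, hRP⟩, hNG⟩ := hcore G hG
  have hgap : HasLatticeMassGap r sch (Δ / 2) :=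
    stub_gapOfRPSpectral G r sch Δ C hΔ (Filter.tendsto_atTop.1 hw 0) hRP
  have hrp : RPSpectral r sch (Δ / 2) (2 * max C 0) :=
    stub_rpSpectralAnti G r sch Δ (Δ / 2) C (by linarith) (by linarith) hRP
  obtain ⟨sch', S₁, hw', h₁⟩ :=
    oneFieldClauses_of_ufbDisjointCore r sch hw hpv hpr hUFB (momentOne_of_ufb G r sch hUFB) (half_pos hΔ) hgap hrp hNG
  exact ⟨r, sch', S₁, hw', h₁⟩

/-- **The twin crux `CoincidenceRotationBootstrap.HypercubicLimit` (stmt-16154) BY NAME from the disjoint RP core** (`stub_siblingTie`).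
[folklore] -/
theorem hypercubicLimit_of_rpCoreDisjoint :
    (∀ (G : Type) [Group G] [TopologicalSpace G] [IsTopologicalGroup G] [CompactSpace G]
          [MeasurableSpace G] [BorelSpace G], IsCompactSimpleLieGroup G →
          ∃ (r : LatticeRep G) (sch : SpeciesScheme (YMSpecies G)),
            sch.HasWeakCouplingLimit ∧ PolyVolume sch ∧ PolyRenorm r sch ∧ UniformFunctionalBoundPlanes r sch ∧
            (∃ Δ C : ℝ, 0 < Δ ∧ RPSpectral r sch Δ C) ∧
            (∃ (f g h : 𝓢(EuclideanSpace ℝ (Fin 4), ℝ)) (δ : ℝ),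
              Disjoint (tsupport f) (tsupport g) ∧ Disjoint (tsupport f) (tsupport h) ∧
              Disjoint (tsupport g) (tsupport h) ∧ 0 < δ ∧
              ∀ᶠ k in atTop, δ ≤
                |latticeSchwinger r.ρ sch (fun s => s.F) k 3 (fun _ => r.curvature) ![f, g, h] -
                  latticeSchwinger r.ρ sch (fun s => s.F) k 1 (fun _ => r.curvature) ![f] *
                    latticeSchwinger r.ρ sch (fun s => s.F) k 2 (fun _ => r.curvature) ![g, h] -
                  latticeSchwinger r.ρ sch (fun s => s.F) k 1 (fun _ => r.curvature) ![g] *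
                    latticeSchwinger r.ρ sch (fun s => s.F) k 2 (fun _ => r.curvature) ![f, h] -
                  latticeSchwinger r.ρ sch (fun s => s.F) k 1 (fun _ => r.curvature) ![h] *
                    latticeSchwinger r.ρ sch (fun s => s.F) k 2 (fun _ => r.curvature) ![f, g] +
                  2 * (latticeSchwinger r.ρ sch (fun s => s.F) k 1 (fun _ => r.curvature) ![f] *
                    latticeSchwinger r.ρ sch (fun s => s.F) k 1 (fun _ => r.curvature) ![g] *
                    latticeSchwinger r.ρ sch (fun s => s.F) k 1 (fun _ => r.curvature) ![h])|)) →
    Summit.QuantumFields.YangMills.Theses.CoincidenceRotationBootstrap.HypercubicLimit := fun hcore =>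
  SiblingTie.stub_siblingTie.1 (weakCouplingHypercubicLimit_of_rpCoreDisjoint hcore)

end Summit.QuantumFields.YangMills.Theorems.WeakCouplingHypercubicLimit.TraceNormColdPressure


end
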